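import Literature.AlgebraicTopology.SingularHomology.EquivariantSingularCochains
import Literature.AlgebraicTopology.SingularHomology.WeakEquivalenceHomology
import Literature.AlgebraicTopology.Homotopy.CoveringSerreFibration
import Literature.AlgebraicTopology.Homotopy.ZeroCellBasepoints
import Literature.Topology.CoveringSpaces.UniversalCoverLift
import HarnessLib

/-!
# `Hⁿ(π₁(X, x₀); M) ≅ Hⁿ(X; M)` for an aspherical space `X`

Topic `Literature/AlgebraicTopology/SingularHomology`.  K. S. Brown, *Cohomology of Groups*
(1982), Ch. I Prop. 4.2 and Prop. II.4.1; A. Hatcher, *Algebraic Topology* (2002), §1.B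
(`K(G,1)` spaces) and Prop. 4.21 / §2.1 (weakly contractible spaces are acyclic): if `X` is a
path connected space with contractible — more generally weakly contractible — universal cover
`X̃` ("aspherical", `πₙ(X) = 0` for `n ≥ 2`), then `X ≃ K(π₁X, 1)` and
`H^*(π₁(X); M) ≅ H^*(X; M)` for every (untwisted) coefficient module `M`, because the singular
chains `C_•(X̃)` form a free resolution of the trivial module over `ℤ[π₁X]` and
`Hom_{π₁}(C_•(X̃), M) = C^•(X; M)`.

This file PROVES the statement for spaces admitting the universal cover of
`Literature/Topology/CoveringSpaces/UniversalCover.lean` (path connected and strongly locally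
contractible, e.g. connected topological manifolds), for Mathlib's `groupCohomology` and the
tree's `singularCohomology`:

* `isZero_csingularHomology_succ_of_subsingleton_homotopyGroup` — a path connected space all of
  whose homotopy groups vanish has zero singular homology in positive degrees (the constant map
  to a point is a weak homotopy equivalence; `isIso_singularHomology_map_of_isWeakHomotopyEquiv`
  of `WeakEquivalenceHomology.lean`, Hatcher Prop. 4.21);
* `subsingleton_homotopyGroup_universalCover`, `isZero_csingularHomology_universalCover` — the
  universal cover of an aspherical space is weakly contractible (`π₁X̃ = 0`:
  `UniversalCover.simplyConnectedSpace`; `πₙX̃ ↪ πₙX = 0` for `n ≥ 2`: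
  `IsCoveringMap.injective_homotopyGroupMap`, Hatcher Prop. 4.1), hence acyclic;
* **`groupCohomologyFundamentalGroupIso`** — `Hⁿ(π₁(X, x₀); M) ≅ Hⁿ(X; M)` for aspherical `X`
  (`Equivariant.groupCohomologyIsoSingularCohomology` of `EquivariantSingularCochains.lean` applied
  to the deck action of `π₁(X, x₀)` on `X̃`, a quotient covering map:
  `UniversalCover.isQuotientCoveringMap_proj`).

## References

* K. S. Brown, *Cohomology of Groups*, GTM 87, Springer 1982, Ch. I Prop. 4.2, Prop. II.4.1.
  [Brown1982CohomologyGroups]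
* A. Hatcher, *Algebraic Topology*, CUP 2002, §1.B p. 87–90, Prop. 4.1, Prop. 4.21. [HatcherAT2002]
-/

noncomputable section

open CategoryTheory CategoryTheory.Limits
open scoped Topology

universe u

namespace Literature.AlgebraicTopology.SingularHomology

open Literature.AlgebraicTopology.Homotopy Literature.Topology.CoveringSpaces

/-! ### Weakly contractible spaces are acyclic -/

/-- **A weakly contractible space is acyclic**: if `E` is path connected and `πₙ(E, e) = 0` for
all `n ≥ 1` and all `e`, then `Hₙ(E; k) = 0` for `n ≥ 1` (the constant map `E → pt` is a weak
homotopy equivalence, hence a homology isomorphism — Hatcher 2002, Prop. 4.21 — and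
`Hₙ(pt) = 0`). Stated for the tree's concrete singular homology `csingularHomology`.
[cite: HatcherAT2002, Prop. 4.21] -/
theorem isZero_csingularHomology_succ_of_subsingleton_homotopyGroup (k : Type u) [CommRing k]
    {E : Type u} [TopologicalSpace E] [PathConnectedSpace E]
    (hE : ∀ (n : ℕ) (e : E), Subsingleton (π_ (n + 1) E e)) (n : ℕ) :
    IsZero (csingularHomology k k E (n + 1)) := by
  let f : C(E, PUnit.{u + 1}) := ContinuousMap.const E PUnit.unit
  have hf : IsWeakHomotopyEquiv f := by
    refine ⟨bijective_zerothHomotopyMap_of_pathConnectedSpace f, fun m e => ?_⟩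
    haveI := hE m e
    haveI : Subsingleton (π_ (m + 1) PUnit.{u + 1} (f e)) :=
      subsingleton_homotopyGroup_of_discreteTopology _
    exact ⟨Function.injective_of_subsingleton _, fun y => ⟨1, Subsingleton.elim _ _⟩⟩
  haveI := isIso_singularHomology_map_of_isWeakHomotopyEquiv k f hf (n + 1)
  have h0 : IsZero (singularHomology k k PUnit.{u + 1} (n + 1)) :=
    isZero_singularHomology_of_subsingleton k k n.succ_ne_zero
  exact (h0.of_iso (asIso (singularHomology.map k k f (n + 1)))).of_iso
    (csingularHomology.compIso k k E (n + 1))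

/-! ### The universal cover of an aspherical space is weakly contractible -/

variable {X : Type u} [TopologicalSpace X] [PathConnectedSpace X] [StronglyLocallyContractibleSpace X]
  (x₀ : X)

/-- **The universal cover of an aspherical space is weakly contractible**: `π₁(X̃) = 0` (it is
simply connected, Hatcher 2002, §1.3 p. 65) and `πₙ(X̃) ↪ πₙ(X) = 0` for `n ≥ 2` (a covering map
is injective on `πₙ`, Hatcher Prop. 4.1); asphericity at one base point suffices (`X` path
connected). [cite: HatcherAT2002, Prop. 4.1 and §1.3 p. 65] -/
theorem subsingleton_homotopyGroup_universalCover
    (hX : ∀ n : ℕ, 2 ≤ n → Subsingleton (π_ n X x₀)) (n : ℕ) (e : UniversalCover X x₀) :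
    Subsingleton (π_ (n + 1) (UniversalCover X x₀) e) := by
  cases n with
  | zero => exact HomotopyGroup.pi1EquivFundamentalGroup.subsingleton
  | succ m =>
    haveI : Subsingleton (π_ (m + 2) X (UniversalCover.proj e)) :=
      subsingleton_homotopyGroup_of_pathConnectedSpace (hX (m + 2) (by omega)) _
    exact (UniversalCover.isCoveringMap_proj.injective_homotopyGroupMap (N := Fin (m + 2))
      e).subsingleton

/-- **The universal cover of an aspherical space is acyclic**: `Hₙ(X̃; k) = 0` for `n ≥ 1`.
[cite: Brown1982CohomologyGroups, Ch. I Prop. 4.2] -/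
theorem isZero_csingularHomology_universalCover (k : Type u) [CommRing k]
    (hX : ∀ n : ℕ, 2 ≤ n → Subsingleton (π_ n X x₀)) (n : ℕ) :
    IsZero (csingularHomology k k (UniversalCover X x₀) (n + 1)) :=
  isZero_csingularHomology_succ_of_subsingleton_homotopyGroup k
    (subsingleton_homotopyGroup_universalCover x₀ hX) n

/-! ### `Hⁿ(π₁(X); M) ≅ Hⁿ(X; M)` -/

/-- **Group cohomology of the fundamental group of an aspherical space is the singular cohomology
of the space**: for `X` path connected, strongly locally contractible (e.g. a connected
topological manifold) and aspherical (`πₙ(X, x₀) = 0` for `n ≥ 2`), and every `k`-module `M`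
(trivial `π₁`-action), `Hⁿ(π₁(X, x₀); M) ≅ Hⁿ(X; M)` — Brown 1982, Prop. II.4.1 ("If `Y` is a
`K(G, 1)`-complex then `H^*(G; M) ≅ H^*(Y; M)`") with Ch. I Prop. 4.2 (`C_*(Ỹ)` is a free
resolution of `ℤ` over `ℤG`); Hatcher 2002, §1.B.  Left: Mathlib's `groupCohomology` of the
trivial representation of `FundamentalGroup X x₀` on `M`; right: the tree's `singularCohomology`.
[cite: Brown1982CohomologyGroups, Prop. II.4.1] -/
def groupCohomologyFundamentalGroupIso (k : Type u) [CommRing k] (M : Type u) [AddCommGroup M]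
    [Module k M] (hX : ∀ n : ℕ, 2 ≤ n → Subsingleton (π_ n X x₀)) (n : ℕ) :
    groupCohomology (Rep.trivial k (FundamentalGroup X x₀) M) n ≅ singularCohomology k M X n :=
  Equivariant.groupCohomologyIsoSingularCohomology k (FundamentalGroup X x₀)
    UniversalCover.isQuotientCoveringMap_proj M (isZero_csingularHomology_universalCover x₀ k hX) n

end Literature.AlgebraicTopology.SingularHomology
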